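import Summits.AtomisticToContinuum.Crystallization.Theorems.SquareWellLayerCakeGapTwelveToBarlowFiveFoldFarDisjointUnit

/-!
# Far disjoint five-fold rings are antipodal — part 3/3: the registered stub

Crux `SquareWellLayerCake.GapTwelveToBarlow` (stmt-AtomisticToContinuum-15807), line `Sketch`,
stub `stub_fiveFoldFarDisjoint` (S2β-FARD), verbatim.  At a site `j` whose `11/10`-neighbourhood
is `55/57`-separated, with the local dichotomy (two sites within `1` of `x j` are `≤ 1` or
`≥ 131/100` apart), let `(j,k)` and `(j,k')` be five-fold bonds (exactly five common neighbours —
the rings `R`, `R'`) with `|x k - x k'| > 1`, `R ∩ R' = ∅` and every site of `R'` having at most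
four common neighbours with `j`.  Then
`⟪x k - x j, x k' - x j⟫ ≤ -(19/20) ‖x k - x j‖ ‖x k' - x j‖`.

Proof (parts 1–2): normalise `x l - x j`; the thick-shell brackets become the cosine thresholds
`0.5345 / 0.4629 / 0.142` (`inner_unit_le_of_sep`, `le_inner_unit_of_bonded`,
`inner_unit_le_of_far`); both rings are two-regular (`fiveFold_ring_closed`, landed); a site
`t ∈ R'` is far from `k` (else `t ∈ R ∩ R'`) and bonded to at most one site of `R` (its bonds to
`j`'s neighbours are `k'`, its two ring partners and at most four in all); `inner_le_of_two_rings`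
concludes.  The hypotheses "`R`-sites have `≤ 4` common neighbours", the twelve-neighbour count and
the exhaustion `N(j) = {k} ∪ R ∪ R' ∪ {k'}` of the registered signature are not needed.

Mathlib + parts 1–2 + the landed ring file only; no named fact is used.
-/

noncomputable section

namespace Summit.AtomisticToContinuum.Crystallization.Theorems.SquareWellLayerCakeGapTwelveToBarlow

open scoped InnerProductSpace ComplexConjugate Real

/-- **Far disjoint five-fold rings are antipodal** (stub `stub_fiveFoldFarDisjoint` of line
`Sketch`, S2β-FARD, registered signature verbatim): two far five-fold bonds `(j,k)`, `(j,k')` at a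
locally separated site with the local `131/100` dichotomy, whose rings are disjoint and whose
`R'`-sites have at most four common neighbours with `j`, satisfy
`⟪x k - x j, x k' - x j⟫ ≤ -(19/20) ‖x k - x j‖ ‖x k' - x j‖` (angle `≥ 161.8°`; the hand proof
gives `cos ≤ -0.959`, numerically the truth is `≈ -0.996`). [folklore] -/
theorem stub_fiveFoldFarDisjoint :
    ∀ (N : ℕ) (x : Fin N → EuclideanSpace ℝ (Fin 3)) (j k : Fin N),
      ((∀ j' : Fin N, dist (x j) (x j') ≤ 11 / 10 → ∀ k' : Fin N, k' ≠ j' →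
          (55 : ℝ) / 57 ≤ dist (x j') (x k')) ∧
        (Finset.univ.filter fun j' : Fin N => j' ≠ j ∧ dist (x j) (x j') ≤ 1).card = 12 ∧
        (Finset.univ.filter fun j' : Fin N => j' ≠ j ∧ dist (x j) (x j') ≤ 11 / 10).card ≤ 12) →
      (∀ l l' : Fin N, dist (x j) (x l) ≤ 1 → dist (x j) (x l') ≤ 1 → 1 < dist (x l) (x l') →
        (131 : ℝ) / 100 ≤ dist (x l) (x l')) →
      j ≠ k → dist (x j) (x k) ≤ 1 →
      (Finset.univ.filter fun l : Fin N =>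
        l ≠ j ∧ l ≠ k ∧ dist (x j) (x l) ≤ 1 ∧ dist (x k) (x l) ≤ 1).card = 5 →
      ∀ k' : Fin N, k' ≠ j → dist (x j) (x k') ≤ 1 →
        (Finset.univ.filter fun l : Fin N =>
          l ≠ j ∧ l ≠ k' ∧ dist (x j) (x l) ≤ 1 ∧ dist (x k') (x l) ≤ 1).card = 5 →
        1 < dist (x k) (x k') →
        Disjoint
          (Finset.univ.filter fun l : Fin N =>
            l ≠ j ∧ l ≠ k ∧ dist (x j) (x l) ≤ 1 ∧ dist (x k) (x l) ≤ 1)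
          (Finset.univ.filter fun l : Fin N =>
            l ≠ j ∧ l ≠ k' ∧ dist (x j) (x l) ≤ 1 ∧ dist (x k') (x l) ≤ 1) →
        (∀ w ∈ (Finset.univ.filter fun l : Fin N =>
            l ≠ j ∧ l ≠ k ∧ dist (x j) (x l) ≤ 1 ∧ dist (x k) (x l) ≤ 1),
          (Finset.univ.filter fun l : Fin N =>
            l ≠ j ∧ l ≠ w ∧ dist (x j) (x l) ≤ 1 ∧ dist (x w) (x l) ≤ 1).card ≤ 4) →
        (∀ w ∈ (Finset.univ.filter fun l : Fin N =>
            l ≠ j ∧ l ≠ k' ∧ dist (x j) (x l) ≤ 1 ∧ dist (x k') (x l) ≤ 1),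
          (Finset.univ.filter fun l : Fin N =>
            l ≠ j ∧ l ≠ w ∧ dist (x j) (x l) ≤ 1 ∧ dist (x w) (x l) ≤ 1).card ≤ 4) →
        (∀ l : Fin N, l ≠ j → dist (x j) (x l) ≤ 1 → l = k ∨ l = k' ∨
          l ∈ (Finset.univ.filter fun l : Fin N =>
            l ≠ j ∧ l ≠ k ∧ dist (x j) (x l) ≤ 1 ∧ dist (x k) (x l) ≤ 1) ∨
          l ∈ (Finset.univ.filter fun l : Fin N =>
            l ≠ j ∧ l ≠ k' ∧ dist (x j) (x l) ≤ 1 ∧ dist (x k') (x l) ≤ 1)) →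
        inner ℝ (x k - x j) (x k' - x j) ≤ -((19 : ℝ) / 20) * (‖x k - x j‖ * ‖x k' - x j‖) := by
  classical
  intro N x j k hGood hgap hjk hdjk h5 k' hk'j hdjk' h5' hkk' hdisj _ hR'4 _
  obtain ⟨hsep, -, -⟩ := hGood
  have hring := fiveFold_ring_closed x j k hjk hdjk hsep hgap h5
  have hring' := fiveFold_ring_closed x j k' (Ne.symm hk'j) hdjk' hsep hgap h5'
  set R := Finset.univ.filter fun l : Fin N =>
    l ≠ j ∧ l ≠ k ∧ dist (x j) (x l) ≤ 1 ∧ dist (x k) (x l) ≤ 1 with hRdef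
  set R' := Finset.univ.filter fun l : Fin N =>
    l ≠ j ∧ l ≠ k' ∧ dist (x j) (x l) ≤ 1 ∧ dist (x k') (x l) ≤ 1 with hR'def
  have hmemR : ∀ l, l ∈ R ↔ l ≠ j ∧ l ≠ k ∧ dist (x j) (x l) ≤ 1 ∧ dist (x k) (x l) ≤ 1 :=
    fun l => by
      rw [hRdef, Finset.mem_filter]
      exact ⟨fun h => h.2, fun h => ⟨Finset.mem_univ _, h⟩⟩
  have hmemR' : ∀ l, l ∈ R' ↔ l ≠ j ∧ l ≠ k' ∧ dist (x j) (x l) ≤ 1 ∧ dist (x k') (x l) ≤ 1 :=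
    fun l => by
      rw [hR'def, Finset.mem_filter]
      exact ⟨fun h => h.2, fun h => ⟨Finset.mem_univ _, h⟩⟩
  -- separation, far pair `k, k'`, disjointness
  have hsepj : ∀ l : Fin N, l ≠ j → (55 : ℝ) / 57 ≤ dist (x j) (x l) :=
    hsep j (by rw [dist_self]; norm_num)
  have hsep2 : ∀ l l' : Fin N, dist (x j) (x l) ≤ 1 → l ≠ l' →
      (55 : ℝ) / 57 ≤ dist (x l) (x l') := fun l l' h hne => hsep l (by linarith) l' hne.symm
  have hRR' : ∀ l, l ∈ R → l ∈ R' → False := fun l h1 h2 => Finset.disjoint_left.mp hdisj h1 h2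
  have hRnb : ∀ l ∈ R, l ≠ j ∧ dist (x j) (x l) ≤ 1 ∧ l ≠ k ∧ dist (x l) (x k) ≤ 1 :=
    fun l hl => by
      obtain ⟨h1, h2, h3, h4⟩ := (hmemR l).1 hl
      exact ⟨h1, h3, h2, by rwa [dist_comm]⟩
  have hR'nb : ∀ l ∈ R', l ≠ j ∧ dist (x j) (x l) ≤ 1 ∧ l ≠ k' ∧ dist (x l) (x k') ≤ 1 :=
    fun l hl => by
      obtain ⟨h1, h2, h3, h4⟩ := (hmemR' l).1 hl
      exact ⟨h1, h3, h2, by rwa [dist_comm]⟩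
  have hR'far : ∀ l ∈ R', 1 < dist (x l) (x k) := by
    intro l hl
    obtain ⟨hlj, -, hjl, hk'l⟩ := (hmemR' l).1 hl
    by_contra! hle
    have hlk : l ≠ k := by
      rintro rfl
      rw [dist_comm] at hk'l
      linarith
    exact hRR' l ((hmemR l).2 ⟨hlj, hlk, hjl, by rwa [dist_comm]⟩) hl
  have hk'R : k' ∉ R := fun h => by
    have h' := (hRnb k' h).2.2.2
    rw [dist_comm] at h'
    linarith
  -- unit vectors
  obtain ⟨v, hv⟩ : ∃ v : Fin N → EuclideanSpace ℝ (Fin 3), ∀ l, v l = x l - x j :=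
    ⟨_, fun _ => rfl⟩
  have hvn : ∀ l, ‖v l‖ = dist (x j) (x l) := fun l => by rw [hv, ← dist_eq_norm, dist_comm]
  have hvd : ∀ l l', ‖v l - v l'‖ = dist (x l) (x l') := fun l l' => by
    rw [hv, hv, sub_sub_sub_cancel_right, ← dist_eq_norm]
  obtain ⟨n, hn⟩ : ∃ n : Fin N → EuclideanSpace ℝ (Fin 3), ∀ l, n l = ‖v l‖⁻¹ • v l :=
    ⟨_, fun _ => rfl⟩
  have hrad : ∀ l, l ≠ j → dist (x j) (x l) ≤ 1 → 55 / 57 ≤ ‖v l‖ ∧ ‖v l‖ ≤ 1 :=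
    fun l hl hd => by
      rw [hvn]
      exact ⟨hsepj l hl, hd⟩
  have hunit : ∀ l, l ≠ j → dist (x j) (x l) ≤ 1 → ‖n l‖ = 1 := fun l hl hd => by
    have h0 : v l ≠ 0 := fun h0 => by
      have h := (hrad l hl hd).1
      rw [h0, norm_zero] at h
      linarith
    rw [hn]
    exact norm_smul_inv_norm h0
  have hcsep : ∀ l l', l ≠ j → dist (x j) (x l) ≤ 1 → l' ≠ j → dist (x j) (x l') ≤ 1 → l ≠ l' →
      ⟪n l, n l'⟫_ℝ ≤ 0.5345 := fun l l' hl hdl hl' hdl' hne => by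
    rw [hn, hn]
    exact inner_unit_le_of_sep (hrad l hl hdl).1 (hrad l hl hdl).2 (hrad l' hl' hdl').1
      (hrad l' hl' hdl').2 (by rw [hvd]; exact hsep2 l l' hdl hne)
  have hcbond : ∀ l l', l ≠ j → dist (x j) (x l) ≤ 1 → l' ≠ j → dist (x j) (x l') ≤ 1 →
      dist (x l) (x l') ≤ 1 → 0.4629 ≤ ⟪n l, n l'⟫_ℝ := fun l l' hl hdl hl' hdl' hb => by
    rw [hn, hn]
    exact le_inner_unit_of_bonded (hrad l hl hdl).1 (hrad l' hl' hdl').1 (by rw [hvd]; exact hb)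
  have hcfar : ∀ l l', l ≠ j → dist (x j) (x l) ≤ 1 → l' ≠ j → dist (x j) (x l') ≤ 1 →
      1 < dist (x l) (x l') → ⟪n l, n l'⟫_ℝ ≤ 0.142 := fun l l' hl hdl hl' hdl' hlt => by
    rw [hn, hn]
    exact inner_unit_le_of_far (hrad l hl hdl).1 (hrad l hl hdl).2 (hrad l' hl' hdl').1
      (hrad l' hl' hdl').2 (by rw [hvd]; exact hgap l l' hdl hdl' hlt)
  -- the two ring partners of a ring site
  have hpartR : ∀ l ∈ R, ∃ a ∈ R, ∃ b ∈ R, a ≠ l ∧ b ≠ l ∧ a ≠ b ∧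
      dist (x l) (x a) ≤ 1 ∧ dist (x l) (x b) ≤ 1 := by
    intro l hl
    obtain ⟨a, b, hab, hEq⟩ := Finset.card_eq_two.mp (hring l hl)
    have ha : a ∈ ({a, b} : Finset (Fin N)) := by simp
    have hb : b ∈ ({a, b} : Finset (Fin N)) := by simp
    rw [← hEq, Finset.mem_filter] at ha hb
    exact ⟨a, ha.1, b, hb.1, ha.2.1, hb.2.1, hab, ha.2.2, hb.2.2⟩
  have hpartR' : ∀ l ∈ R', ∃ a ∈ R', ∃ b ∈ R', a ≠ l ∧ b ≠ l ∧ a ≠ b ∧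
      dist (x l) (x a) ≤ 1 ∧ dist (x l) (x b) ≤ 1 := by
    intro l hl
    obtain ⟨a, b, hab, hEq⟩ := Finset.card_eq_two.mp (hring' l hl)
    have ha : a ∈ ({a, b} : Finset (Fin N)) := by simp
    have hb : b ∈ ({a, b} : Finset (Fin N)) := by simp
    rw [← hEq, Finset.mem_filter] at ha hb
    exact ⟨a, ha.1, b, hb.1, ha.2.1, hb.2.1, hab, ha.2.2, hb.2.2⟩
  -- a site of `R'` is bonded to at most one site of `R`
  have hone : ∀ i ∈ R', ∀ a ∈ R, ∀ b ∈ R, a ≠ b →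
      ⟪n a, n i⟫_ℝ ≤ 0.142 ∨ ⟪n b, n i⟫_ℝ ≤ 0.142 := by
    intro i hi a ha b hb hab
    by_contra! H
    obtain ⟨Ha, Hb⟩ := H
    obtain ⟨hij, hji, hik', hik'd⟩ := hR'nb i hi
    obtain ⟨haj, hja, -, -⟩ := hRnb a ha
    obtain ⟨hbj, hjb, -, -⟩ := hRnb b hb
    have hda : dist (x a) (x i) ≤ 1 := by
      by_contra! hlt
      exact absurd (hcfar a i haj hja hij hji hlt) (not_le.2 Ha)
    have hdb : dist (x b) (x i) ≤ 1 := by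
      by_contra! hlt
      exact absurd (hcfar b i hbj hjb hij hji hlt) (not_le.2 Hb)
    obtain ⟨a', ha', b', hb', ha'i, hb'i, ha'b', hda', hdb'⟩ := hpartR' i hi
    obtain ⟨ha'j, hja', ha'k', -⟩ := hR'nb a' ha'
    obtain ⟨hb'j, hjb', hb'k', -⟩ := hR'nb b' hb'
    have hai : a ≠ i := fun h => hRR' a ha (h ▸ hi)
    have hbi : b ≠ i := fun h => hRR' b hb (h ▸ hi)
    have hak' : a ≠ k' := fun h => hk'R (h ▸ ha)
    have hbk' : b ≠ k' := fun h => hk'R (h ▸ hb)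
    have haa' : a ≠ a' := fun h => hRR' a ha (h ▸ ha')
    have hab' : a ≠ b' := fun h => hRR' a ha (h ▸ hb')
    have hba' : b ≠ a' := fun h => hRR' b hb (h ▸ ha')
    have hbb' : b ≠ b' := fun h => hRR' b hb (h ▸ hb')
    have h1 : a ∉ ({b, k', a', b'} : Finset (Fin N)) := by
      simp only [Finset.mem_insert, Finset.mem_singleton, not_or]
      exact ⟨hab, hak', haa', hab'⟩
    have h2 : b ∉ ({k', a', b'} : Finset (Fin N)) := by
      simp only [Finset.mem_insert, Finset.mem_singleton, not_or]
      exact ⟨hbk', hba', hbb'⟩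
    have h3 : k' ∉ ({a', b'} : Finset (Fin N)) := by
      simp only [Finset.mem_insert, Finset.mem_singleton, not_or]
      exact ⟨fun h => ha'k' h.symm, fun h => hb'k' h.symm⟩
    have hcard : ({a, b, k', a', b'} : Finset (Fin N)).card = 5 := by
      rw [Finset.card_insert_of_notMem h1, Finset.card_insert_of_notMem h2,
        Finset.card_insert_of_notMem h3, Finset.card_pair ha'b']
    refine absurd (hR'4 i hi) (not_le.2 (lt_of_lt_of_le (by norm_num) (hcard.symm.le.trans
      (Finset.card_le_card ?_))))
    intro l hl
    simp only [Finset.mem_insert, Finset.mem_singleton] at hl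
    rw [Finset.mem_filter]
    refine ⟨Finset.mem_univ _, ?_⟩
    rcases hl with rfl | rfl | rfl | rfl | rfl
    · exact ⟨haj, hai, hja, by rwa [dist_comm]⟩
    · exact ⟨hbj, hbi, hjb, by rwa [dist_comm]⟩
    · exact ⟨hk'j, fun h => hik' h.symm, hdjk', hik'd⟩
    · exact ⟨ha'j, ha'i, hja', hda'⟩
    · exact ⟨hb'j, hb'i, hjb', hdb'⟩
  -- the unit-vector theorem
  have hRne : R.Nonempty := by
    rw [← Finset.card_pos, h5]
    norm_num
  have hR'ne : R'.Nonempty := by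
    rw [← Finset.card_pos, h5']
    norm_num
  have key := inner_le_of_two_rings R R' hRne hR'ne (n k) (n k') n (hunit k hjk.symm hdjk)
    (hunit k' hk'j hdjk') (fun l hl => hunit l (hRnb l hl).1 (hRnb l hl).2.1)
    (fun l hl => hunit l (hR'nb l hl).1 (hR'nb l hl).2.1)
    (fun l hl => ⟨hcbond l k (hRnb l hl).1 (hRnb l hl).2.1 hjk.symm hdjk (hRnb l hl).2.2.2,
      hcsep l k (hRnb l hl).1 (hRnb l hl).2.1 hjk.symm hdjk (hRnb l hl).2.2.1⟩)
    (fun l hl => ⟨hcbond l k' (hR'nb l hl).1 (hR'nb l hl).2.1 hk'j hdjk' (hR'nb l hl).2.2.2,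
      hcsep l k' (hR'nb l hl).1 (hR'nb l hl).2.1 hk'j hdjk' (hR'nb l hl).2.2.1⟩)
    (fun l hl l' hl' hne => hcsep l l' (hRnb l hl).1 (hRnb l hl).2.1 (hRnb l' hl').1
      (hRnb l' hl').2.1 hne)
    (fun l hl l' hl' hne => hcsep l l' (hR'nb l hl).1 (hR'nb l hl).2.1 (hR'nb l' hl').1
      (hR'nb l' hl').2.1 hne)
    (fun l hl => by
      obtain ⟨a, ha, b, hb, hal, hbl, hab, hda, hdb⟩ := hpartR l hl
      exact ⟨a, ha, b, hb, hal, hbl, hab,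
        hcbond l a (hRnb l hl).1 (hRnb l hl).2.1 (hRnb a ha).1 (hRnb a ha).2.1 hda,
        hcbond l b (hRnb l hl).1 (hRnb l hl).2.1 (hRnb b hb).1 (hRnb b hb).2.1 hdb⟩)
    (fun l hl => by
      obtain ⟨a, ha, b, hb, hal, hbl, hab, hda, hdb⟩ := hpartR' l hl
      exact ⟨a, ha, b, hb, hal, hbl, hab,
        hcbond l a (hR'nb l hl).1 (hR'nb l hl).2.1 (hR'nb a ha).1 (hR'nb a ha).2.1 hda,
        hcbond l b (hR'nb l hl).1 (hR'nb l hl).2.1 (hR'nb b hb).1 (hR'nb b hb).2.1 hdb⟩)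
    (fun l hl => hcfar l k (hR'nb l hl).1 (hR'nb l hl).2.1 hjk.symm hdjk (hR'far l hl))
    (fun i hi l hl => hcsep i l (hRnb i hi).1 (hRnb i hi).2.1 (hR'nb l hl).1 (hR'nb l hl).2.1
      (fun h => hRR' i hi (h ▸ hl)))
    hone (hcfar k k' hjk.symm hdjk hk'j hdjk' hkk')
  -- back to the configuration
  have hk0 : 0 < ‖v k‖ := by linarith [(hrad k hjk.symm hdjk).1]
  have hk'0 : 0 < ‖v k'‖ := by linarith [(hrad k' hk'j hdjk').1]
  rw [hn, hn, inner_unit_unit, div_le_iff₀ (mul_pos hk0 hk'0), hv, hv] at key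
  linarith

end Summit.AtomisticToContinuum.Crystallization.Theorems.SquareWellLayerCakeGapTwelveToBarlow

end
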